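import Mathlib
import Literature.MathematicalPhysics.QuantumFieldTheory.Balaban1983to89.B9Eq333Cov
import Literature.MathematicalPhysics.QuantumFieldTheory.Balaban1983to89.B8Eq194FirstTerm

/-!
# [4] (3.31)–(3.33): gauge covariance of Q′, Δ^η_U, G′, (Q′G′²Q′*)⁻¹, R and H′ ON THE (3.25)-LATTICE CARRIERS
# `B9Thm311Lattice` — the intertwining hypotheses of `B9Eq333Cov` discharged, kernel-checked

statement-level skeleton of published theorems with citation tags; proofs where landed; nothing here is a claim
about the Yang–Mills mass gap

Seat p40 gen 9, Phase 2 (free target; owner r06 row B9.Eq3.28, xref r05 row B8.Eq1.91).  Source: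
[Balaban1985BackgroundPropagators] T. Bałaban, *Propagators for lattice gauge theories in a background field*, CMP 99
(1985) 389–434, pp. 395–396 [PDF 7–8] (OCR pages p0007/p0008 read this session), (3.19) p. 393, (3.23)–(3.25) p. 394;
[Balaban1985RegularSpaces] (1.91) p. 91.

WHAT IS PRINTED (verbatim, p. 395–396).  «if we make the transformations U → U^u, … where U^u(x,x′) =
u(x)U(x,x′)u⁻¹(x′) (3.28) … For the covariant Laplace operator (3.23) we have ⟨R(u)λ, Δ^η_{U^u}R(u)λ⟩ = ⟨λ, Δ^η_Uλ⟩,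
hence Δ^η_{U^u} = R(u)Δ^η_UR(u⁻¹). (3.31)  The matrices in the definitions (3.19) transform as follows
R(U^u(Γ^{(j)}_{y,x})) = R(u(y))R(U(Γ^{(j)}_{y,x}))R(u⁻¹(x)), hence (Q′_j(U^u)R(u)λ)(y) = R(u(y))(Q′_j(U)λ)(y), (3.32)
and Q′*(U^u)aQ′(U^u) = R(u)Q′*(U)aQ′(U)R(u⁻¹).  The equalities (3.31), (3.32) imply further
G′(U^u) = R(u)G′(U)R(u⁻¹), R(U^u) = R(u)R(U)R(u⁻¹). (3.33)»

WHY THIS FILE.  pub-balaban's `B9Eq333Cov` certifies the two printed words «imply further» as INTERTWINING ALGEBRA over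
abstract inner-product spaces, with (3.31) and (3.32) as HYPOTHESES (`h31`, `h32a`, `h32b`) and R(u), R(u(·)) as
abstract scalar-product preserving maps T, S.  On the cell's CONCRETE carriers of (3.19)/(3.23)–(3.25)
(`B9Thm311Lattice`: E = PiLp 2 (X → 𝔤), F = PiLp 2 (Y → 𝔤), Q′ = `qL τ w B Γ y` with the contour transports
`pathTr`, Δ = `lapL τ bonds cb` = D†D, the letters G′ = `B8Eq191Hprime.gL`, (Q′G′²Q′*)⁻¹ = `cL`, H′ = `HpL` with
bodies for every background) nothing of (3.31)–(3.33) was typed.  This file types the gauge transformation of the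
transports and PROVES (3.31), (3.32) there, so that (3.33) — and the covariance of both operators called H′
((1.91)'s `Hp` and [4]'s (3.163) `H4`) and of the criterion Q′ΔN(Q′) = 0 of the cell's GAPS G-B8-19 — hold on the
carriers for every background U, every gauge transformation u : X → O(𝔤), every block system.

CONTENT.
§1 `conjT u τ` — the transports of U^u: R(U^u(b)) = R(u(x))R(U(b))R(u(x′))⁻¹ for u x ∈ O(𝔤) = `V ≃ₗᵢ[ℝ] V`
   ((3.28)); `conjT_injective`; **`pathTr_conjT`** = the printed «R(U^u(Γ_{y,x})) = R(u(y))R(U(Γ_{y,x}))R(u⁻¹(x))»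
   (along any site list); R(u) on E, F and on bond functions = `gaugeE`, `gaugeF`, `gaugeB` (Mathlib
   `LinearIsometryEquiv.piLpCongrRight`).
§2 **`qL_conjT`** = (3.32) «(Q′(U^u)R(u)λ)(y) = R(u(y))(Q′(U)λ)(y)» (needs only that Γ_{y,x} ends at x);
   **`covD_conjT`**, **`DL_conjT`** (D_{U^u}R(u) = R(u)D_U), **`lapL_conjT`** = (3.31) Δ_{U^u}R(u) = R(u)Δ_U;
   `AL_gaugeF` (a commutes with R(u(·))), `adjoint_qL_conjT` (Q′* covariant — orthogonality of R(u)), `h32b_L`.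
§3 (3.33) FOR THE LATTICE LETTERS OF RECORD, every background: **`gL_conjT`** (G′(U^u)R(u) = R(u)G′(U)),
   **`cL_conjT`** ((Q′G′²Q′*)⁻¹), **`R325_conjT`** (R(U^u)R(u) = R(u)R(U)), **`HpL_conjT`** ((1.91)'s H′),
   **`H4_conjT`** ([4]'s H′ of (3.163)) — by `B9Eq333Cov.g_intertwine` / `c_intertwine` / `R_intertwine` /
   `qs_intertwine` with every hypothesis discharged.
§4 **`criterion_conjT_iff`** — «Δ maps N(Q′) into N(Q′)» is gauge invariant on the carriers; `conjT_flat_apply`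
   (§1: a pure gauge u(x)u(x′)⁻¹ is the gauge transform of U = 1), hence **`criterion_pureGauge_iff`**: at every pure-gauge
   background the criterion is that of the flat background (so, for the scalar fibre, the classifications of
   `B8Eq194CriterionTorus/…Free/…Carriers` apply verbatim — G-B8-19 (c)).

HONEST SCOPE.  Gauge group acting on the fibre 𝔤 = V through ANY family of linear isometries u x (print: R(u(x)) =
Ad(u(x)), orthogonal for the invariant form tr X*Y — the orthogonality is exactly what Q′* and R need, as
`B9Eq333Cov` located); block weights w, bond weights c_b and the averaging weights a are gauge-inert scalars; the
vector-field operators of (3.30)/(3.34) (Δ^η(U), Δ_a, G on E₁) are not on these carriers and not treated; no bound.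

Sources read: OCR `paper:balaban1985-cmp99-background-propagators` p0007–p0008 (pp. 395–396); (3.19), (3.23)–(3.25)
from the carriers' own headers.
-/

namespace Literature.MathematicalPhysics.QuantumFieldTheory.Balaban1983to89.B9Eq331LatticeCov

open Finset Literature.MathematicalPhysics.QuantumFieldTheory.Balaban1983to89.B9Eq323Ker
  Literature.MathematicalPhysics.QuantumFieldTheory.Balaban1983to89.B9Eq319Onto
  Literature.MathematicalPhysics.QuantumFieldTheory.Balaban1983to89.B9Thm311Lattice
  Literature.MathematicalPhysics.QuantumFieldTheory.Balaban1983to89.B9Eq325Proj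
  Literature.MathematicalPhysics.QuantumFieldTheory.Balaban1983to89.B9Thm311Data
  Literature.MathematicalPhysics.QuantumFieldTheory.Balaban1983to89.B9Eq333Cov
  Literature.MathematicalPhysics.QuantumFieldTheory.Balaban1983to89.B8Eq191Hprime
  Literature.MathematicalPhysics.QuantumFieldTheory.Balaban1983to89.B8Eq194FirstTerm
open scoped InnerProductSpace

/-! ## §1  The transports of U^u and R(u) on the carriers -/

section Transport

variable {X : Type*} {V : Type*} [NormedAddCommGroup V] [InnerProductSpace ℝ V]

/-- **(3.28) on the transports**: R(U^u(⟨x,x′⟩)) = R(u(x)) R(U(⟨x,x′⟩)) R(u(x′))⁻¹, the gauge transformation acting on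
the fibre through the linear isometries u x. [cite: Balaban1985BackgroundPropagators, (3.28) p. 395, (3.32) p. 395] -/
def conjT (u : X → V ≃ₗᵢ[ℝ] V) (τ : X → X → V →ₗ[ℝ] V) : X → X → V →ₗ[ℝ] V :=
  fun x x' => (u x).toLinearEquiv.toLinearMap ∘ₗ τ x x' ∘ₗ (u x').symm.toLinearEquiv.toLinearMap

/-- Pointwise form of `conjT`. [cite: Balaban1985BackgroundPropagators, (3.28) p. 395] -/
theorem conjT_apply (u : X → V ≃ₗᵢ[ℝ] V) (τ : X → X → V →ₗ[ℝ] V) (x x' : X) (v : V) :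
    conjT u τ x x' v = u x (τ x x' ((u x').symm v)) := rfl

/-- The transports of U^u are injective when those of U are (hypothesis `hinj` of the carriers).
[cite: Balaban1985BackgroundPropagators, (3.28) p. 395] -/
theorem conjT_injective (u : X → V ≃ₗᵢ[ℝ] V) {τ : X → X → V →ₗ[ℝ] V}
    (hinj : ∀ x x' : X, Function.Injective (τ x x')) (x x' : X) : Function.Injective (conjT u τ x x') := by
  intro v v' h
  rw [conjT_apply, conjT_apply] at h
  exact (u x').symm.injective (hinj x x' ((u x).injective h))

/-- **«R(U^u(Γ_{y,x})) = R(u(y)) R(U(Γ_{y,x})) R(u⁻¹(x))»** along any site list [y, …, x] (head y, last x).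
[cite: Balaban1985BackgroundPropagators, (3.32) p. 395] -/
theorem pathTr_conjT (u : X → V ≃ₗᵢ[ℝ] V) (τ : X → X → V →ₗ[ℝ] V) :
    ∀ (x₀ : X) (rest : List X) (v : V), pathTr (conjT u τ) (x₀ :: rest) v
      = u x₀ (pathTr τ (x₀ :: rest) ((u ((x₀ :: rest).getLast (List.cons_ne_nil _ _))).symm v))
  | x₀, [], v => by simp [pathTr_singleton]
  | x₀, x₁ :: rest, v => by
    rw [pathTr_cons_cons, LinearMap.comp_apply, pathTr_conjT u τ x₁ rest v, conjT_apply,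
      LinearIsometryEquiv.symm_apply_apply, pathTr_cons_cons, LinearMap.comp_apply, List.getLast_cons_cons]

/-- The gauge transform of the FLAT background U = 1 is the pure gauge u(x)u(x′)⁻¹.
[cite: Balaban1985BackgroundPropagators, (3.28) p. 395] -/
theorem conjT_flat_apply (u : X → V ≃ₗᵢ[ℝ] V) (x x' : X) (v : V) :
    conjT u (fun _ _ => LinearMap.id) x x' v = u x ((u x').symm v) := rfl

variable [Fintype X]

/-- R(u) on E = L²(Ω₀, 𝔤) = PiLp 2 (X → V): (R(u)λ)(x) = R(u(x))λ(x), a linear isometry of E onto E.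
[cite: Balaban1985BackgroundPropagators, (3.31)–(3.32) p. 395] -/
noncomputable def gaugeE (u : X → V ≃ₗᵢ[ℝ] V) : PiLp 2 (fun _ : X => V) ≃ₗᵢ[ℝ] PiLp 2 (fun _ : X => V) :=
  LinearIsometryEquiv.piLpCongrRight 2 fun x => u x

/-- Pointwise form of `gaugeE`. [cite: Balaban1985BackgroundPropagators, (3.32) p. 395] -/
theorem gaugeE_apply (u : X → V ≃ₗᵢ[ℝ] V) (f : PiLp 2 (fun _ : X => V)) (x : X) : gaugeE u f x = u x (f x) := rfl

variable {Y : Type*} [Fintype Y]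

/-- R(u(·)) on F = L²(𝔅) = PiLp 2 (Y → V): (R(u(·))φ)(c) = R(u(y_c))φ(c), u taken at the block centre y_c.
[cite: Balaban1985BackgroundPropagators, (3.32) p. 395] -/
noncomputable def gaugeF (u : X → V ≃ₗᵢ[ℝ] V) (y : Y → X) :
    PiLp 2 (fun _ : Y => V) ≃ₗᵢ[ℝ] PiLp 2 (fun _ : Y => V) :=
  LinearIsometryEquiv.piLpCongrRight 2 fun c => u (y c)

omit [Fintype X] in
/-- Pointwise form of `gaugeF`. [cite: Balaban1985BackgroundPropagators, (3.32) p. 395] -/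
theorem gaugeF_apply (u : X → V ≃ₗᵢ[ℝ] V) (y : Y → X) (φ : PiLp 2 (fun _ : Y => V)) (c : Y) :
    gaugeF u y φ c = u (y c) (φ c) := rfl

/-- R(u(b₋)) on the bond functions PiLp 2 (bonds → V) (the target of D). [cite: Balaban1985BackgroundPropagators,
(3.31) p. 395] -/
noncomputable def gaugeB (u : X → V ≃ₗᵢ[ℝ] V) (bonds : Finset (X × X)) :
    PiLp 2 (fun _ : ↥bonds => V) ≃ₗᵢ[ℝ] PiLp 2 (fun _ : ↥bonds => V) :=
  LinearIsometryEquiv.piLpCongrRight 2 fun b => u b.1.1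

omit [Fintype X] in
/-- Pointwise form of `gaugeB`. [cite: Balaban1985BackgroundPropagators, (3.31) p. 395] -/
theorem gaugeB_apply (u : X → V ≃ₗᵢ[ℝ] V) (bonds : Finset (X × X)) (F : PiLp 2 (fun _ : ↥bonds => V))
    (b : ↥bonds) : gaugeB u bonds F b = u b.1.1 (F b) := rfl

end Transport

/-! ## §2  (3.32) and (3.31) on the carriers -/

section Covariance

variable {X : Type*} {Y : Type*} {V : Type*} [NormedAddCommGroup V] [InnerProductSpace ℝ V]
variable [Fintype X] [Fintype Y]
variable (u : X → V ≃ₗᵢ[ℝ] V) (τ : X → X → V →ₗ[ℝ] V)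

/-- **(3.32)** «(Q′(U^u)R(u)λ)(y) = R(u(y))(Q′(U)λ)(y)» on the carriers, for every system of contours Γ_{y,x} ending at
x (the `last` clause of `IsBlockSystem`). [cite: Balaban1985BackgroundPropagators, (3.32) p. 395, (3.19) p. 393] -/
theorem qL_conjT {w : Y → X → ℝ} {B : Y → Finset X} {Γ : Y → X → List X} {y : Y → X}
    (hlast : ∀ c, ∀ x ∈ B c, (y c :: Γ c x).getLast (List.cons_ne_nil _ _) = x) (f : PiLp 2 (fun _ : X => V)) :
    qL (conjT u τ) w B Γ y (gaugeE u f) = gaugeF u y (qL τ w B Γ y f) := by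
  ext c
  rw [gaugeF_apply, qL_apply, qL_apply]
  unfold avgQ
  rw [map_sum]
  refine Finset.sum_congr rfl fun x hx => ?_
  rw [map_smul, pathTr_conjT]
  congr 2
  have hl := hlast c x hx
  have e : (u ((y c :: Γ c x).getLast (List.cons_ne_nil _ _))).symm (WithLp.ofLp (gaugeE u f) x)
      = WithLp.ofLp f x := by
    rw [hl]
    exact (u x).symm_apply_apply (f x)
  rw [e]

omit [Fintype X] [Fintype Y] in
/-- **D_{U^u} R(u) = R(u(b₋)) D_U** pointwise: (D_{U^u}(R(u)λ))(⟨x,x′⟩) = R(u(x))(D_Uλ)(⟨x,x′⟩).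
[cite: Balaban1985BackgroundPropagators, (3.3) p. 390, (3.31) p. 395] -/
theorem covD_conjT (l : X → V) (x x' : X) :
    covD (conjT u τ) (fun z => u z (l z)) x x' = u x (covD τ l x x') := by
  simp only [covD, conjT_apply, LinearIsometryEquiv.symm_apply_apply, map_sub]

/-- D of (3.23) is covariant: D_{U^u} R(u) = R(u(b₋)) D_U on the carriers.
[cite: Balaban1985BackgroundPropagators, (3.23) p. 394, (3.31) p. 395] -/
theorem DL_conjT (bonds : Finset (X × X)) (cb : X × X → ℝ) (f : PiLp 2 (fun _ : X => V)) :
    DL (conjT u τ) bonds cb (gaugeE u f) = gaugeB u bonds (DL τ bonds cb f) := by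
  ext b
  rw [gaugeB_apply, DL_apply, DL_apply, map_smul]
  congr 1
  exact covD_conjT u τ (WithLp.ofLp f) b.1.1 b.1.2

variable [FiniteDimensional ℝ V]

/-- **(3.31)** «⟨R(u)λ, Δ^η_{U^u}R(u)λ⟩ = ⟨λ, Δ^η_Uλ⟩, hence Δ^η_{U^u} = R(u)Δ^η_UR(u⁻¹)» on the carriers, in
intertwining form Δ_{U^u}R(u) = R(u)Δ_U (Δ = D†D and D covariant, R(u) orthogonal).
[cite: Balaban1985BackgroundPropagators, (3.31) p. 395] -/
theorem lapL_conjT (bonds : Finset (X × X)) (cb : X × X → ℝ) (f : PiLp 2 (fun _ : X => V)) :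
    lapL (conjT u τ) bonds cb (gaugeE u f) = gaugeE u (lapL τ bonds cb f) := by
  refine ext_inner_right ℝ fun g' => ?_
  obtain ⟨g, rfl⟩ := (gaugeE u).surjective g'
  rw [inner_lapL_left, DL_conjT, DL_conjT, LinearIsometryEquiv.inner_map_map, LinearIsometryEquiv.inner_map_map,
    inner_lapL_left]

/-- The printed quadratic-form statement of (3.31): ⟨R(u)λ, Δ_{U^u}R(u)λ⟩ = ⟨λ, Δ_Uλ⟩.
[cite: Balaban1985BackgroundPropagators, (3.31) p. 395] -/
theorem inner_lapL_conjT (bonds : Finset (X × X)) (cb : X × X → ℝ) (f : PiLp 2 (fun _ : X => V)) :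
    ⟪gaugeE u f, lapL (conjT u τ) bonds cb (gaugeE u f)⟫_ℝ = ⟪f, lapL τ bonds cb f⟫_ℝ := by
  rw [lapL_conjT, LinearIsometryEquiv.inner_map_map]

omit [Fintype X] [FiniteDimensional ℝ V] in
/-- The averaging weights a = diag(a_c) are gauge inert: a R(u(·)) = R(u(·)) a.
[cite: Balaban1985BackgroundPropagators, (3.32) p. 395 («Q′*(U^u)aQ′(U^u) = R(u)Q′*(U)aQ′(U)R(u⁻¹)»)] -/
theorem AL_gaugeF (a : Y → ℝ) (y : Y → X) (φ : PiLp 2 (fun _ : Y => V)) :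
    AL a (gaugeF u y φ) = gaugeF u y (AL a φ) := by
  ext c
  rw [AL_apply, gaugeF_apply, gaugeF_apply, AL_apply, map_smul]

/-- Q′* is covariant: Q′*(U^u)R(u(·)) = R(u)Q′*(U) — from (3.32) and the ORTHOGONALITY of R(u), R(u(·))
(`B9Eq333Cov.adj_intertwine`). [cite: Balaban1985BackgroundPropagators, (3.32) p. 395, (3.24) p. 394] -/
theorem adjoint_qL_conjT {w : Y → X → ℝ} {B : Y → Finset X} {Γ : Y → X → List X} {y : Y → X}
    (hlast : ∀ c, ∀ x ∈ B c, (y c :: Γ c x).getLast (List.cons_ne_nil _ _) = x) (φ : PiLp 2 (fun _ : Y => V)) :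
    LinearMap.adjoint (qL (conjT u τ) w B Γ y) (gaugeF u y φ)
      = gaugeE u (LinearMap.adjoint (qL τ w B Γ y) φ) :=
  adj_intertwine (T := (gaugeE u).toLinearEquiv.toLinearMap) (S := (gaugeF u y).toLinearEquiv.toLinearMap)
    (qL_adjoint_pair τ w B Γ y) (qL_adjoint_pair (conjT u τ) w B Γ y)
    (fun f g => (gaugeE u).inner_map_map f g) (fun φ ψ => (gaugeF u y).inner_map_map φ ψ)
    (gaugeE u).surjective (fun f => qL_conjT u τ hlast f) φ

/-- (3.32b) in the form `B9Eq333Cov` consumes: (Q′*aQ′)(U^u)R(u) = R(u)(Q′*aQ′)(U).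
[cite: Balaban1985BackgroundPropagators, (3.32) p. 395] -/
theorem h32b_L {w : Y → X → ℝ} {B : Y → Finset X} {Γ : Y → X → List X} {y : Y → X}
    (hlast : ∀ c, ∀ x ∈ B c, (y c :: Γ c x).getLast (List.cons_ne_nil _ _) = x) (a : Y → ℝ)
    (f : PiLp 2 (fun _ : X => V)) :
    LinearMap.adjoint (qL (conjT u τ) w B Γ y) (AL a (qL (conjT u τ) w B Γ y (gaugeE u f)))
      = gaugeE u (LinearMap.adjoint (qL τ w B Γ y) (AL a (qL τ w B Γ y f))) := by
  rw [qL_conjT u τ hlast, AL_gaugeF, adjoint_qL_conjT u τ hlast]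

end Covariance

/-! ## §3  «(3.31), (3.32) imply further (3.33)» — for the lattice letters of record, every background -/

section Letters

variable {X : Type*} {Y : Type*} {V : Type*} [NormedAddCommGroup V] [InnerProductSpace ℝ V]
variable [Fintype X] [Fintype Y] [FiniteDimensional ℝ V]
variable (u : X → V ≃ₗᵢ[ℝ] V) {τ : X → X → V →ₗ[ℝ] V} {bonds : Finset (X × X)} {cb : X × X → ℝ} {w : Y → X → ℝ}
  {B : Y → Finset X} {Γ : Y → X → List X} {y : Y → X} {a : Y → ℝ}
  (hinj : ∀ x x' : X, Function.Injective (τ x x')) (hcb : ∀ b ∈ bonds, 0 < cb b) (hS : IsBlockSystem bonds w B Γ y)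
  (ha : ∀ c, 0 < a c)

/-- **(3.33a)** G′(U^u)R(u) = R(u)G′(U) for the lattice G′ = (Δ + Q′*aQ′)⁻¹ of record (`B8Eq191Hprime.gL`).
[cite: Balaban1985BackgroundPropagators, (3.33) p. 396] -/
theorem gL_conjT (f : PiLp 2 (fun _ : X => V)) :
    gL (conjT u τ) cb a (conjT_injective u hinj) hcb hS ha (gaugeE u f) = gaugeE u (gL τ cb a hinj hcb hS ha f) :=
  g_intertwine (T := (gaugeE u).toLinearEquiv.toLinearMap) (data_L hinj hcb hS ha)
    (data_L (conjT_injective u hinj) hcb hS ha) (fun g => lapL_conjT u τ bonds cb g)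
    (fun g => h32b_L u τ hS.last a g) f

/-- (Q′G′²Q′*)⁻¹(U^u)R(u(·)) = R(u(·))(Q′G′²Q′*)⁻¹(U) for the lattice letter `cL`.
[cite: Balaban1985BackgroundPropagators, (3.33) p. 396] -/
theorem cL_conjT (φ : PiLp 2 (fun _ : Y => V)) :
    cL (conjT u τ) cb a (conjT_injective u hinj) hcb hS ha (gaugeF u y φ)
      = gaugeF u y (cL τ cb a hinj hcb hS ha φ) :=
  c_intertwine (T := (gaugeE u).toLinearEquiv.toLinearMap) (S := (gaugeF u y).toLinearEquiv.toLinearMap)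
    (data_L hinj hcb hS ha) (data_L (conjT_injective u hinj) hcb hS ha) (fun g => lapL_conjT u τ bonds cb g)
    (fun g => qL_conjT u τ hS.last g) (fun g => h32b_L u τ hS.last a g) (fun f g => (gaugeE u).inner_map_map f g)
    (fun φ ψ => (gaugeF u y).inner_map_map φ ψ) (gaugeE u).surjective φ

/-- **(3.33b)** R(U^u)R(u) = R(u)R(U) for the projection R of (3.21)/(3.25) built on the lattice letters.
[cite: Balaban1985BackgroundPropagators, (3.33) p. 396, (3.25) p. 394] -/
theorem R325_conjT (f : PiLp 2 (fun _ : X => V)) :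
    R325 (qL (conjT u τ) w B Γ y) (LinearMap.adjoint (qL (conjT u τ) w B Γ y))
        (gL (conjT u τ) cb a (conjT_injective u hinj) hcb hS ha) (cL (conjT u τ) cb a (conjT_injective u hinj) hcb hS ha)
        (gaugeE u f)
      = gaugeE u (R325 (qL τ w B Γ y) (LinearMap.adjoint (qL τ w B Γ y)) (gL τ cb a hinj hcb hS ha)
          (cL τ cb a hinj hcb hS ha) f) :=
  R_intertwine (T := (gaugeE u).toLinearEquiv.toLinearMap) (S := (gaugeF u y).toLinearEquiv.toLinearMap)
    (data_L hinj hcb hS ha) (data_L (conjT_injective u hinj) hcb hS ha) (fun g => lapL_conjT u τ bonds cb g)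
    (fun g => qL_conjT u τ hS.last g) (fun g => h32b_L u τ hS.last a g) (fun f g => (gaugeE u).inner_map_map f g)
    (fun φ ψ => (gaugeF u y).inner_map_map φ ψ) (gaugeE u).surjective f

/-- **(1.91)'s H′ is covariant**: H′(U^u)R(u(·)) = R(u)H′(U) for the lattice H′ = G′²Q′*(Q′G′²Q′*)⁻¹ (`HpL`).
[cite: Balaban1985RegularSpaces, (1.91) p. 91; Balaban1985BackgroundPropagators, (3.33) p. 396] -/
theorem HpL_conjT (φ : PiLp 2 (fun _ : Y => V)) :
    HpL (conjT u τ) cb a (conjT_injective u hinj) hcb hS ha (gaugeF u y φ)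
      = gaugeE u (HpL τ cb a hinj hcb hS ha φ) := by
  unfold HpL
  rw [Hp_apply, Hp_apply, cL_conjT u hinj hcb hS ha, adjoint_qL_conjT u τ hS.last, gL_conjT u hinj hcb hS ha,
    gL_conjT u hinj hcb hS ha]

/-- **[4]'s H′ of (3.163) is covariant too**: H′₍₄₎(U^u)R(u(·)) = R(u)H′₍₄₎(U) (`B8Eq194FirstTerm.H4` on the lattice
letters). [cite: Balaban1985BackgroundPropagators, (3.163) p. 429, (3.33) p. 396] -/
theorem H4_conjT (μ : PiLp 2 (fun _ : Y => V)) :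
    H4 (qL (conjT u τ) w B Γ y) (LinearMap.adjoint (qL (conjT u τ) w B Γ y)) (AL a)
        (gL (conjT u τ) cb a (conjT_injective u hinj) hcb hS ha) (cL (conjT u τ) cb a (conjT_injective u hinj) hcb hS ha)
        (gaugeF u y μ)
      = gaugeE u (H4 (qL τ w B Γ y) (LinearMap.adjoint (qL τ w B Γ y)) (AL a) (gL τ cb a hinj hcb hS ha)
          (cL τ cb a hinj hcb hS ha) μ) := by
  have hH : ∀ φ, Hp (LinearMap.adjoint (qL (conjT u τ) w B Γ y))
      (gL (conjT u τ) cb a (conjT_injective u hinj) hcb hS ha) (cL (conjT u τ) cb a (conjT_injective u hinj) hcb hS ha)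
      (gaugeF u y φ)
      = gaugeE u (Hp (LinearMap.adjoint (qL τ w B Γ y)) (gL τ cb a hinj hcb hS ha) (cL τ cb a hinj hcb hS ha) φ) :=
    HpL_conjT u hinj hcb hS ha
  rw [H4_apply, H4_apply, AL_gaugeF, adjoint_qL_conjT u τ hS.last, gL_conjT u hinj hcb hS ha, qL_conjT u τ hS.last,
    ← map_sub, hH, map_add]

end Letters

/-! ## §4  The criterion Q′ΔN(Q′) = 0 is gauge invariant; pure-gauge backgrounds -/

section Criterion

variable {X : Type*} {Y : Type*} {V : Type*} [NormedAddCommGroup V] [InnerProductSpace ℝ V]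
variable [Fintype X] [Fintype Y] [FiniteDimensional ℝ V]
variable (u : X → V ≃ₗᵢ[ℝ] V) (τ : X → X → V →ₗ[ℝ] V)

/-- **«Δ maps N(Q′) into N(Q′)» is gauge invariant** on the carriers: the criterion of GAPS G-B8-19 for U^u ⟺ for U
(any bond weights, any block system whose contours end where they should).
[cite: Balaban1985BackgroundPropagators, (3.31)–(3.32) p. 395, (3.163)–(3.165) p. 429] -/
theorem criterion_conjT_iff (bonds : Finset (X × X)) (cb : X × X → ℝ) {w : Y → X → ℝ} {B : Y → Finset X}
    {Γ : Y → X → List X} {y : Y → X} (hlast : ∀ c, ∀ x ∈ B c, (y c :: Γ c x).getLast (List.cons_ne_nil _ _) = x) :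
    (∀ l, qL (conjT u τ) w B Γ y l = 0 → qL (conjT u τ) w B Γ y (lapL (conjT u τ) bonds cb l) = 0)
      ↔ (∀ l, qL τ w B Γ y l = 0 → qL τ w B Γ y (lapL τ bonds cb l) = 0) := by
  constructor
  · intro h l hl
    have h1 : qL (conjT u τ) w B Γ y (gaugeE u l) = 0 := by rw [qL_conjT u τ hlast, hl, map_zero]
    have h2 := h _ h1
    rw [lapL_conjT, qL_conjT u τ hlast] at h2
    exact (gaugeF u y).map_eq_zero_iff.1 h2
  · intro h l' hl'
    obtain ⟨l, rfl⟩ := (gaugeE u).surjective l'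
    rw [qL_conjT u τ hlast] at hl'
    have hl : qL τ w B Γ y l = 0 := (gaugeF u y).map_eq_zero_iff.1 hl'
    rw [lapL_conjT, qL_conjT u τ hlast, h l hl, map_zero]

/-- **Pure-gauge backgrounds**: at U(⟨x,x′⟩) = u(x)u(x′)⁻¹ (the gauge transform of U = 1) the criterion is that of
the flat background. [cite: Balaban1985BackgroundPropagators, (3.28) p. 395, (3.163)–(3.165) p. 429] -/
theorem criterion_pureGauge_iff (bonds : Finset (X × X)) (cb : X × X → ℝ) {w : Y → X → ℝ} {B : Y → Finset X}
    {Γ : Y → X → List X} {y : Y → X} (hlast : ∀ c, ∀ x ∈ B c, (y c :: Γ c x).getLast (List.cons_ne_nil _ _) = x) :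
    (∀ l, qL (conjT u fun _ _ => LinearMap.id) w B Γ y l = 0 →
        qL (conjT u fun _ _ => LinearMap.id) w B Γ y (lapL (conjT u fun _ _ => LinearMap.id) bonds cb l) = 0)
      ↔ (∀ l, qL (fun _ _ => (LinearMap.id : V →ₗ[ℝ] V)) w B Γ y l = 0 →
        qL (fun _ _ => (LinearMap.id : V →ₗ[ℝ] V)) w B Γ y (lapL (fun _ _ => LinearMap.id) bonds cb l) = 0) :=
  criterion_conjT_iff u _ bonds cb hlast

end Criterion

end Literature.MathematicalPhysics.QuantumFieldTheory.Balaban1983to89.B9Eq331LatticeCov
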